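import Literature.NumberTheory.Rogawski1990.LocalStableClassesNonsplitScalarFrameKappa
import Literature.NumberTheory.Rogawski1990.KottwitzSignDiagonalModel
import Literature.NumberTheory.Automorphic.LocalUnitaryGroupCompactOfAnisotropic
import Literature.NumberTheory.Automorphic.UnitaryGroupBlockCentralizer
import Literature.NumberTheory.Automorphic.LocalOrbitalMeasure
import HarnessLib

/-!
# The COMPACT DOCK at the second class of the scalar partner: `Z_{G′_v}(ε′)` is compact when `Z_{G′_v}(ε)` is not
# (Rogawski 1990, §3.8 Prop. 3.8.1 (a)(d): `G_{ε′} ≅ U(2)ᵃⁿ × E¹`; proof of Prop. 8.2.1, the two classes `ε`, `ε′`)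

Topic `NumberTheory/Rogawski1990`; namespace `Literature.NumberTheory.Rogawski1990`.  **THEOREMS ONLY** (no definition, no named fact, no instance,
no notation, no `sorry`).  Cell `pub/hodgecm-mathlib`, programme P3a, road «N6nsGerm» (crux H413), brick **(D2ε′)-dock «COMPACT DOCK AT THE SECOND CLASS»**
(LEAD F0P3a-plan (g9) WORD T8-101): B-p08 (g27)'s `hI′` junction `LocalTransferCompactSideJunctionCM` takes an ABSTRACT compact group `C′` docked at the
bad class; the ED. 1.4 dress instantiates `C′ := Z_{G′_v}(ε′)` itself, so the one fact needed is the compactness of that centraliser.  Seat A-p17 (g21).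
HONEST LABEL: HC_CM is proved only modulo the printed citations until rung 0 closes; this file is unconditional local algebra ∕ topology.

THE MATHEMATICS.  `γ_H = (e·1₂, u)` the scalar partner (`(u − e)²` a unit), `v` non-split.  A match `b = T·(e·1₂ ⊕ᶠ u·1₁)·T⁻¹ ∈ G′_v = U(H′_v)(F_v)` framed by
`T = g P₀` has `ᵗ(σT) H′_v T = G₁ ⊕ᶠ G₂` (★ `exists_twistGram_eq_finSum_of_scalar_frame`); conjugating by `T`, `Z_{G′_v}(b) = T · (U(G₁) × U(G₂)) · T⁻¹`
(★ `mem_range_blockDiagFin_iff_commute`: the centraliser of a block scalar in `U(G₁ ⊕ᶠ G₂)` is the block-diagonal subgroup).  So `Z(b)` is compact as soon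
as `G₁` is ANISOTROPIC (★ `isCompact_unitaryGroupOfForm_conjLocal_of_anisotropic`, `G₂` being a unit scalar) — §1.  For two NON-conjugate matches `b, b′`
the signs differ (★ `finKappaAt_eq_neg_of_not_isConj_of_fst_eq_smul_one`), i.e. exactly one of the corners `G₂`, `G′₂` is a norm; since
`det Gᵢ · (corner) = N(det Tᵢ)·det H′_v`, the classes of `−det G₁` and `−det G′₁` differ by a non-norm; if `Z(b)` is NOT compact, `G₁` is isotropic, so `−det G₁`
is a norm (★ `exists_neg_det_eq_norm_of_hermForm_eq_zero`), hence `−det G′₁` is not, `G′₁` is anisotropic and `Z(b′)` is compact — §2.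

* §1 **`compactSpace_centralizer_of_frame_of_anisotropic`** (a framed unitary element with scalar blocks and anisotropic blocks has compact centraliser).
* §2 **`compactSpace_centralizer_of_not_isConj_of_fst_eq_smul_one`** — the (D2ε′)-dock head: `¬ CompactSpace Z(b)`, `b ≁ b′` ⇒ `CompactSpace Z(b′)`.

## References
* [Rogawski1990] J. D. Rogawski, *Automorphic Representations of Unitary Groups in Three Variables*, Ann. of Math. Stud. 123 (1990), §3.8 Prop. 3.8.1 (a)(d)
  pp. 27–30, §8.2 Prop. 8.2.1 pp. 118–122.
* [PlatonovRapinchuk1994] V. Platonov, A. Rapinchuk, *Algebraic Groups and Number Theory* (1994), §3.1 Thm. 3.1.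
* [Jacobowitz1962] R. Jacobowitz, *Hermitian forms over local fields*, Amer. J. Math. 84 (1962), §3.
-/

set_option autoImplicit false

noncomputable section

open NumberField IsDedekindDomain Matrix Topology
open scoped MatrixGroups

namespace Literature.NumberTheory.Rogawski1990

open Literature.NumberTheory.Automorphic Literature.NumberTheory.Automorphic.UnitaryGroup Literature.NumberTheory.GaloisRepresentations
open Literature.AlgebraicGeometry.ShimuraVarieties (unitaryGroup)

/-! ## §0 Generic matrix identities (ring-generic, so that no `3 × 3` computation runs over `∏_w L_w`) -/

section Generic

variable {S : Type*} [CommRing S] (σ : S →+* S)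

omit σ in
/-- The transposition matrix `(e₁ e₃ e₂)` is an involution. [folklore] -/
private theorem swapMatrix_mul_self₇ : (!![1, 0, 0; 0, 0, 1; 0, 1, 0] : Matrix (Fin 3) (Fin 3) S) * !![1, 0, 0; 0, 0, 1; 0, 1, 0] = 1 := by
  rw [Matrix.one_fin_three]
  ext i j; fin_cases i <;> fin_cases j <;> simp

omit σ in
/-- `diag(e, u, e) · (e₁ e₃ e₂) = (e₁ e₃ e₂) · diag(e, e, u)`. [folklore] -/
private theorem diag_mul_swapMatrix₇ (e u : S) :
    (!![e, 0, 0; 0, u, 0; 0, 0, e] : Matrix (Fin 3) (Fin 3) S) * !![1, 0, 0; 0, 0, 1; 0, 1, 0] = !![1, 0, 0; 0, 0, 1; 0, 1, 0] * !![e, 0, 0; 0, e, 0; 0, 0, u] := by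
  ext i j; fin_cases i <;> fin_cases j <;> simp

omit σ in
/-- `diag(e, e, u)` as an explicit `3 × 3` matrix. [folklore] -/
private theorem diagonal_three_eq₇ (e u : S) : (diagonal ![e, e, u] : Matrix (Fin 3) (Fin 3) S) = !![e, 0, 0; 0, e, 0; 0, 0, u] := by
  ext i j; fin_cases i <;> fin_cases j <;> simp

omit σ in
/-- The `(inr i, inr j)` entry of `A ⊕ᶠ B` is `B i j`. [folklore] -/
private theorem finSum_apply_inr₇ {N₁ N₂ : ℕ} (A : Matrix (Fin N₁) (Fin N₁) S) (B : Matrix (Fin N₂) (Fin N₂) S) (i j : Fin N₂) :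
    finSum N₁ N₂ A B (finSumFinEquiv (Sum.inr i)) (finSumFinEquiv (Sum.inr j)) = B i j := by
  rw [finSum, reindex_apply, submatrix_apply, Equiv.symm_apply_apply, Equiv.symm_apply_apply, fromBlocks_apply₂₂]

/-- A rank-one hermitian form with unit coefficient is anisotropic when `σ(s) s = 0 ⇒ s = 0`. [folklore] -/
private theorem hermForm_fin_one_anisotropic₇ (hN : ∀ s : S, σ s * s = 0 → s = 0) {G : Matrix (Fin 1) (Fin 1) S} (hG : IsUnit (G 0 0))
    (x : Fin 1 → S) (hx : hermForm σ G x x = 0) : x = 0 := by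
  have hx' : hermForm σ G x x = G 0 0 * (σ (x 0) * x 0) := by
    simp [hermForm, dotProduct, mulVec]; ring
  rw [hx'] at hx
  have h0 : σ (x 0) * x 0 = 0 := (hG.mul_right_eq_zero).1 hx
  funext i
  rw [Subsingleton.elim i 0, Pi.zero_apply]
  exact hN _ h0

/-- Norm bookkeeping: `σ(a)·a·x′ = σ(c)·c·x` with `a` a unit ⇒ `x′ = σ(q) q x` for the unit `q = c a⁻¹`. [folklore] -/
private theorem exists_norm_mul_of_norm_mul_eq₇ {a c x x' : S} (ha : IsUnit a) (hc : IsUnit c)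
    (h : σ a * a * x' = σ c * c * x) : ∃ q : S, IsUnit q ∧ x' = σ q * q * x := by
  obtain ⟨ainv, hainv⟩ := ha.exists_right_inv
  have hσa : σ a * σ ainv = 1 := by rw [← map_mul, hainv, map_one]
  refine ⟨c * ainv, hc.mul (IsUnit.of_mul_eq_one_right _ hainv), ?_⟩
  rw [map_mul]
  linear_combination (σ ainv * ainv) * h - (x' * (a * ainv)) * hσa - x' * hainv

/-- Determinant bookkeeping for the two frames: `−A = N(z₀)`, `−A′ = N(z₁)`, `A x = σ(d) D₀ d`, `A′ x′ = σ(d′) D₀ d′` ⇒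
`N(z₁ d)·x′ = N(z₀ d′)·x` (both are `−D₀ N(d) N(d′)`). [folklore] -/
private theorem norm_frame_rel₇ {z₀ z₁ d d' D₀ A A' x x' : S} (hz₀ : -A = σ z₀ * z₀) (hz₁ : -A' = σ z₁ * z₁)
    (hd : A * x = σ d * D₀ * d) (hd' : A' * x' = σ d' * D₀ * d') :
    σ (z₁ * d) * (z₁ * d) * x' = σ (z₀ * d') * (z₀ * d') * x := by
  rw [map_mul, map_mul]
  linear_combination (-(σ d * d * x')) * hz₁ + (-(σ d * d)) * hd' + (σ d' * d' * x) * hz₀ + (σ d' * d') * hd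

end Generic

/-! ## §1 A framed element with scalar blocks and anisotropic Gram blocks has compact centraliser -/

section Frame

variable (L : Type) [Field L] [NumberField L] [IsCMField L] (v : HeightOneSpectrum (𝓞 ↥(maximalRealSubfield L)))
  (H' : Matrix (Fin 3) (Fin 3) L) (b : (UnitaryGroup.cmDatum L 3 H').Local v)

/-- **A FRAMED UNITARY ELEMENT WITH SCALAR BLOCKS AND ANISOTROPIC GRAM BLOCKS HAS COMPACT CENTRALISER** (`v` non-split): if `b ∈ G′_v = U(H′_v)(F_v)` satisfies
`b·T = T·(e·1₂ ⊕ᶠ u·1₁)` (`e − u` a unit) and `ᵗ(σT) H′_v T = G₁ ⊕ᶠ G₂` with `G₁` ANISOTROPIC and `G₂` a unit scalar, then `Z_{G′_v}(b)` is compact: it is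
`T · (U(G₁) × U(G₂)) · T⁻¹` (★ `mem_range_blockDiagFin_iff_commute`), a continuous image of a compact (★ `isCompact_unitaryGroupOfForm_conjLocal_of_anisotropic`),
closed in `G′_v`. [cite: Rogawski1990, §3.8 Prop. 3.8.1 (a) p. 27, (d) p. 30] [cite: PlatonovRapinchuk1994, §3.1 Thm. 3.1] -/
theorem compactSpace_centralizer_of_frame_of_anisotropic (w : UnitaryGroup.PlacesOver L v) (hw : IsCMField.complexConj L • w.1 = w.1)
    {T : GL (Fin 3) (UnitaryGroup.LocalRing L v)} {e u : UnitaryGroup.LocalRing L v} (heu : IsUnit (e - u))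
    (hT : (b.val.val : Matrix (Fin 3) (Fin 3) (UnitaryGroup.LocalRing L v)) * T.val =
      T.val * finSum 2 1 (e • (1 : Matrix (Fin 2) (Fin 2) (UnitaryGroup.LocalRing L v))) (u • (1 : Matrix (Fin 1) (Fin 1) (UnitaryGroup.LocalRing L v))))
    {G₁ : Matrix (Fin 2) (Fin 2) (UnitaryGroup.LocalRing L v)} {G₂ : Matrix (Fin 1) (Fin 1) (UnitaryGroup.LocalRing L v)}
    (hG : twistGram (UnitaryGroup.conjLocal L (IsCMField.complexConj L) v) ((UnitaryGroup.adelicForm L 3 H').map (UnitaryGroup.adeleToLocal L v)) T.val =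
      finSum 2 1 G₁ G₂)
    (hanis : ∀ x : Fin 2 → UnitaryGroup.LocalRing L v, hermForm (UnitaryGroup.conjLocal L (IsCMField.complexConj L) v) G₁ x x = 0 → x = 0)
    (hG₂ : IsUnit (G₂ 0 0)) :
    CompactSpace ↥(Subgroup.centralizer ({b} : Set ((UnitaryGroup.cmDatum L 3 H').Local v))) := by
  classical
  have hc1 : IsCMField.complexConj L ≠ 1 := IsCMField.complexConj_ne_one L
  obtain ⟨δ, hcδ, hδ⟩ : ∃ δ : L, IsCMField.complexConj L δ = -δ ∧ δ ≠ 0 := by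
    obtain ⟨ζ, hζ⟩ := not_forall.1 fun h0 => IsCMField.complexConj_ne_one L (AlgEquiv.ext h0)
    refine ⟨ζ - IsCMField.complexConj L ζ, by rw [map_sub, IsCMField.complexConj_apply_apply, neg_sub], fun h0 => hζ ?_⟩
    rw [sub_eq_zero] at h0
    exact h0.symm
  haveI : Algebra.IsQuadraticExtension ↥(maximalRealSubfield L) L := IsCMField.isQuadraticExtension L
  set σ := UnitaryGroup.conjLocal L (IsCMField.complexConj L) v with hσdef
  set Hv := (UnitaryGroup.adelicForm L 3 H').map (UnitaryGroup.adeleToLocal L v) with hHvdef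
  set D := finSum 2 1 (e • (1 : Matrix (Fin 2) (Fin 2) (UnitaryGroup.LocalRing L v))) (u • (1 : Matrix (Fin 1) (Fin 1) (UnitaryGroup.LocalRing L v)))
    with hD
  -- `G₂` is anisotropic too (a unit scalar on a line; `E_v` is a field at a non-split place)
  have hN : ∀ s : UnitaryGroup.LocalRing L v, σ s * s = 0 → s = 0 := by
    letI : Field (UnitaryGroup.LocalRing L v) :=
      (Liu2021.LemD1IndexedNonVacuityNonsplitPlace.isField_localRing_of_nonsplit L v (IsCMField.complexConj L) hcδ hδ w hw).toField
    intro s hs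
    rcases mul_eq_zero.1 hs with h | h
    · exact (map_eq_zero_iff σ (RingHom.injective _)).1 h
    · exact h
  have hanis₂ : ∀ x : Fin 1 → UnitaryGroup.LocalRing L v, hermForm σ G₂ x x = 0 → x = 0 :=
    hermForm_fin_one_anisotropic₇ σ hN hG₂
  -- compactness of the two unitary blocks
  haveI : CompactSpace ↥(unitaryGroupOfForm σ G₁) :=
    isCompact_iff_compactSpace.1 (isCompact_unitaryGroupOfForm_conjLocal_of_anisotropic (IsCMField.complexConj L) hc1 v w hw G₁ hanis)
  haveI : CompactSpace ↥(unitaryGroupOfForm σ G₂) :=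
    isCompact_iff_compactSpace.1 (isCompact_unitaryGroupOfForm_conjLocal_of_anisotropic (IsCMField.complexConj L) hc1 v w hw G₂ hanis₂)
  -- the parametrisation `t ↦ T · (t₁ ⊕ᶠ t₂) · T⁻¹`
  let f : ↥(unitaryGroupOfForm σ G₁) × ↥(unitaryGroupOfForm σ G₂) → GL (Fin 3) (UnitaryGroup.LocalRing L v) :=
    fun t => T * ((blockDiagFin σ G₁ G₂ t : ↥(unitaryGroupOfForm σ (finSum 2 1 G₁ G₂))) : GL (Fin (2 + 1)) (UnitaryGroup.LocalRing L v)) * T⁻¹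
  have hf : Continuous f :=
    (continuous_const.mul (continuous_subtype_val.comp (continuous_blockDiagFin σ G₁ G₂))).mul continuous_const
  have hS : IsCompact (Set.range f) := isCompact_range hf
  -- every element of the centraliser is in the image
  have hsub : (↑(Subgroup.centralizer ({b} : Set ((UnitaryGroup.cmDatum L 3 H').Local v))) : Set ((UnitaryGroup.cmDatum L 3 H').Local v)) ⊆
      (Subtype.val : (UnitaryGroup.cmDatum L 3 H').Local v → GL (Fin 3) (UnitaryGroup.LocalRing L v)) ⁻¹' Set.range f := by
    intro x hx
    rw [SetLike.mem_coe, Subgroup.mem_centralizer_singleton_iff] at hx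
    have hxb : x.val * b.val = b.val * x.val := congrArg Subtype.val hx
    -- `y := T⁻¹ x T` commutes with `D` and is unitary for `G₁ ⊕ᶠ G₂`
    set y : GL (Fin 3) (UnitaryGroup.LocalRing L v) := T⁻¹ * x.val * T with hy
    have hTinv : (T⁻¹).val * T.val = 1 := by rw [← Units.val_mul, inv_mul_cancel, Units.val_one]
    have hTinv' : T.val * (T⁻¹).val = 1 := by rw [← Units.val_mul, mul_inv_cancel, Units.val_one]
    have hD' : (T⁻¹).val * b.val.val * T.val = D := by
      rw [Matrix.mul_assoc, hT, ← Matrix.mul_assoc, hTinv, Matrix.one_mul]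
    have hyD : y.val * D = D * y.val := by
      rw [hy, Units.val_mul, Units.val_mul, ← hD']
      have hxb' : (x.val.val : Matrix (Fin 3) (Fin 3) _) * b.val.val = b.val.val * x.val.val := by
        rw [← Units.val_mul, ← Units.val_mul, hxb]
      calc (T⁻¹).val * x.val.val * T.val * ((T⁻¹).val * b.val.val * T.val)
          = (T⁻¹).val * x.val.val * (T.val * (T⁻¹).val) * b.val.val * T.val := by simp only [Matrix.mul_assoc]
        _ = (T⁻¹).val * (x.val.val * b.val.val) * T.val := by rw [hTinv', Matrix.mul_one]; simp only [Matrix.mul_assoc]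
        _ = (T⁻¹).val * (b.val.val * x.val.val) * T.val := by rw [hxb']
        _ = (T⁻¹).val * b.val.val * (T.val * (T⁻¹).val) * x.val.val * T.val := by rw [hTinv', Matrix.mul_one]; simp only [Matrix.mul_assoc]
        _ = (T⁻¹).val * b.val.val * T.val * ((T⁻¹).val * x.val.val * T.val) := by simp only [Matrix.mul_assoc]
    have hyU : y ∈ unitaryGroupOfForm σ (finSum 2 1 G₁ G₂) := by
      rw [mem_unitaryGroupOfForm_iff, ← hG, ← twistGram_mul, hy, Units.val_mul, Units.val_mul, ← Matrix.mul_assoc,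
        ← Matrix.mul_assoc, hTinv', Matrix.one_mul, twistGram_unitary_mul σ Hv x.2]
    obtain ⟨t, ht⟩ := (mem_range_blockDiagFin_iff_commute σ G₁ G₂ heu ⟨y, hyU⟩).2 hyD
    refine ⟨t, ?_⟩
    show T * ((blockDiagFin σ G₁ G₂ t : ↥(unitaryGroupOfForm σ (finSum 2 1 G₁ G₂))) : GL (Fin (2 + 1)) _) * T⁻¹ = x.val
    rw [ht]
    show T * (T⁻¹ * x.val * T) * T⁻¹ = x.val
    rw [← mul_assoc, ← mul_assoc, mul_inv_cancel, one_mul, mul_inv_cancel_right]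
  -- conclude: closed subset of the preimage of a compact under the closed embedding `G′_v ↪ GL₃`
  have hce : IsClosedEmbedding (Subtype.val : (UnitaryGroup.cmDatum L 3 H').Local v → GL (Fin 3) (UnitaryGroup.LocalRing L v)) :=
    IsClosedEmbedding.subtypeVal (UnitaryGroup.isClosed_local L (IsCMField.complexConj L) 3 H' v)
  have hK : IsCompact (Subtype.val ⁻¹' Set.range f : Set ((UnitaryGroup.cmDatum L 3 H').Local v)) := hce.isCompact_preimage hS
  exact isCompact_iff_compactSpace.1 (hK.of_isClosed_subset (isClosed_coe_centralizer_singleton b) hsub)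

end Frame

/-! ## §2 The (D2ε′) dock: the centraliser of the second class is compact -/

section Dock

variable (L : Type) [Field L] [NumberField L] [IsCMField L] (v : HeightOneSpectrum (𝓞 ↥(maximalRealSubfield L)))
  (H' : Matrix (Fin 3) (Fin 3) L)
  (a : (UnitaryGroup.cmDatum L 2 (Matrix.of fun i j : Fin 2 => if i.val + j.val + 1 = 2 then (1 : L) else 0)).Local v ×
      (UnitaryGroup.cmDatum L 1 (Matrix.of fun i j : Fin 1 => if i.val + j.val + 1 = 1 then (1 : L) else 0)).Local v)
  (b b' : (UnitaryGroup.cmDatum L 3 H').Local v)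

set_option maxHeartbeats 400000 in -- the statement's `GL₃(∏_w L_w)`-level unifications at `whnf` exceed the default budget
open scoped Classical in
/-- **THE (D2ε′) DOCK — `Z_{G′_v}(ε′)` IS COMPACT**: at a non-split `v`, for the scalar partner `γ_H = (e·1₂, u)` (`(u − e)²` a unit) and two matches
`ε = b`, `ε′ = b′` which are NOT conjugate in `U(H′_v)(F_v)`, if `Z_{G′_v}(b)` is NOT compact (the docked class: `Z(ε) ≅ H_v = U(1,1) × U(1)`) then
`Z_{G′_v}(b′)` IS compact (`≅ U(2)ᵃⁿ × E¹`) — the opposite signs of the two classes (★ `finKappaAt_eq_neg_of_not_isConj_of_fst_eq_smul_one`) make exactly one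
rank-two Gram block anisotropic. This is the compact group `C′` of the `hI′` junction with `θ′ = id`. [cite: Rogawski1990, §3.8 Prop. 3.8.1 (a)(d) pp. 27–30;
§8.2 Prop. 8.2.1 pp. 118–122] [cite: PlatonovRapinchuk1994, §3.1 Thm. 3.1] [cite: Jacobowitz1962, §3] -/
theorem compactSpace_centralizer_of_not_isConj_of_fst_eq_smul_one (w : UnitaryGroup.PlacesOver L v) (hw : IsCMField.complexConj L • w.1 = w.1)
    (h : IsLocalNormPair L H' v a b) (h' : IsLocalNormPair L H' v a b') (hu : IsUnit ((finCharpolyTwo L v a).eval (finGammaTwo L v a)))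
    (hH : (((UnitaryGroup.adelicForm L 3 H').map (UnitaryGroup.adeleToLocal L v)).map
      (UnitaryGroup.conjLocal L (IsCMField.complexConj L) v))ᵀ = (UnitaryGroup.adelicForm L 3 H').map (UnitaryGroup.adeleToLocal L v))
    (hHd : IsUnit ((UnitaryGroup.adelicForm L 3 H').map (UnitaryGroup.adeleToLocal L v)).det)
    {e : UnitaryGroup.LocalRing L v} (ha : (a.1.val.val : Matrix (Fin 2) (Fin 2) (UnitaryGroup.LocalRing L v)) = e • (1 : Matrix (Fin 2) (Fin 2) _))
    (hne : ¬ IsConj (⟨b.val, b.2⟩ : unitaryGroup (UnitaryGroup.conjLocal L (IsCMField.complexConj L) v)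
        ((UnitaryGroup.adelicForm L 3 H').map (UnitaryGroup.adeleToLocal L v))) ⟨b'.val, b'.2⟩)
    (hb : ¬ CompactSpace ↥(Subgroup.centralizer ({b} : Set ((UnitaryGroup.cmDatum L 3 H').Local v)))) :
    CompactSpace ↥(Subgroup.centralizer ({b'} : Set ((UnitaryGroup.cmDatum L 3 H').Local v))) := by
  classical
  obtain ⟨δ, hcδ, hδ⟩ : ∃ δ : L, IsCMField.complexConj L δ = -δ ∧ δ ≠ 0 := by
    obtain ⟨ζ, hζ⟩ := not_forall.1 fun h0 => IsCMField.complexConj_ne_one L (AlgEquiv.ext h0)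
    refine ⟨ζ - IsCMField.complexConj L ζ, by rw [map_sub, IsCMField.complexConj_apply_apply, neg_sub], fun h0 => hζ ?_⟩
    rw [sub_eq_zero] at h0
    exact h0.symm
  haveI : Algebra.IsQuadraticExtension ↥(maximalRealSubfield L) L := IsCMField.isQuadraticExtension L
  have hσσ : ∀ s, UnitaryGroup.conjLocal L (IsCMField.complexConj L) v (UnitaryGroup.conjLocal L (IsCMField.complexConj L) v s) = s :=
    Liu2021.LemD1OfPlace.conjLocal_conjLocal_apply L v (IsCMField.complexConj L) hcδ hδ
  have hv : Subsingleton (UnitaryGroup.PlacesOver L v) :=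
    UnitaryGroup.PlacesOver.subsingleton_of_smul_eq (IsCMField.complexConj L) (IsCMField.complexConj_ne_one L) w hw
  set σ := UnitaryGroup.conjLocal L (IsCMField.complexConj L) v with hσdef
  set Hv := (UnitaryGroup.adelicForm L 3 H').map (UnitaryGroup.adeleToLocal L v) with hHvdef
  set u := finGammaTwo L v a with hudef
  have he1 : σ e * e = 1 := conjLocal_mul_self_of_fst_eq_smul_one L v a ha
  have hu1 : σ u * u = 1 := conjLocal_finGammaTwo_mul_finGammaTwo L v a
  have heu : IsUnit (e - u) := by
    have h2 : IsUnit ((u - e) ^ 2) := by rw [← eval_finCharpolyTwo_of_fst_eq_smul_one L v a ha]; exact hu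
    rw [← neg_sub]
    exact ((isUnit_pow_iff two_ne_zero).1 h2).neg
  -- `ι_v(γ_H)`, the transposition frame, the scalar-block frame
  set γ₀ : GL (Fin 3) (UnitaryGroup.LocalRing L v) := (endoEmbLocal L v a).val with hγ₀
  have hι : (γ₀.val : Matrix (Fin 3) (Fin 3) (UnitaryGroup.LocalRing L v)) = !![e, 0, 0; 0, u, 0; 0, 0, e] := by
    rw [hγ₀, coe_endoEmbLocal, coe_endoGL_eq, ha]
    exact scalar_endoPattern_eq e u
  set P₀m : Matrix (Fin 3) (Fin 3) (UnitaryGroup.LocalRing L v) := !![1, 0, 0; 0, 0, 1; 0, 1, 0] with hP₀m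
  have hP₀P₀ : P₀m * P₀m = 1 := swapMatrix_mul_self₇
  set P₀ : GL (Fin 3) (UnitaryGroup.LocalRing L v) := ⟨P₀m, P₀m, hP₀P₀, hP₀P₀⟩ with hP₀
  have hP₀val : P₀.val = P₀m := rfl
  set D := finSum 2 1 (e • (1 : Matrix (Fin 2) (Fin 2) (UnitaryGroup.LocalRing L v))) (u • (1 : Matrix (Fin 1) (Fin 1) (UnitaryGroup.LocalRing L v)))
    with hD
  have hDdiag : D = diagonal ![e, e, u] := finSum_smul_one_eq_diagonal e u
  set j : Fin 3 := finSumFinEquiv (m := 2) (n := 1) (Sum.inr 0) with hjdef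
  have hj2 : j = 2 := by rw [hjdef]; decide
  have hj : (![e, e, u] : Fin 3 → UnitaryGroup.LocalRing L v) j = finGammaTwo L v a := by
    rw [hj2]
    show (![e, e, u] : Fin 3 → UnitaryGroup.LocalRing L v) 2 = u
    rfl
  have hDexp : D = !![e, 0, 0; 0, e, 0; 0, 0, u] := by rw [hDdiag]; exact diagonal_three_eq₇ e u
  have hframe : γ₀.val * P₀.val = P₀.val * D := by
    rw [hι, hP₀val, hDexp]
    exact diag_mul_swapMatrix₇ e u
  -- conjugators and frames of the two matches
  obtain ⟨g, hg⟩ := isConj_iff.1 ((isLocalNormPair_iff L H' v a b).1 h)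
  obtain ⟨g', hg'⟩ := isConj_iff.1 ((isLocalNormPair_iff L H' v a b').1 h')
  rw [← hγ₀] at hg hg'
  have hgγ : g.val * γ₀.val = b.val.val * g.val := by
    rw [← Units.val_mul, ← Units.val_mul, ← hg, inv_mul_cancel_right]
  have hg'γ : g'.val * γ₀.val = b'.val.val * g'.val := by
    rw [← Units.val_mul, ← Units.val_mul, ← hg', inv_mul_cancel_right]
  have hγ₀g : γ₀ ∈ unitaryGroup σ (twistGram σ Hv g.val) := by
    rw [Literature.AlgebraicGeometry.ShimuraVarieties.mem_unitaryGroup_iff, ← twistGram_mul, hgγ, twistGram_unitary_mul σ Hv b.2]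
  have hγ₀g' : γ₀ ∈ unitaryGroup σ (twistGram σ Hv g'.val) := by
    rw [Literature.AlgebraicGeometry.ShimuraVarieties.mem_unitaryGroup_iff, ← twistGram_mul, hg'γ, twistGram_unitary_mul σ Hv b'.2]
  obtain ⟨G₁, G₂, hGP⟩ := exists_twistGram_eq_finSum_of_scalar_frame (N₁ := 2) (N₂ := 1) σ hγ₀g hframe he1 hu1 heu
  obtain ⟨G'₁, G'₂, hG'P⟩ := exists_twistGram_eq_finSum_of_scalar_frame (N₁ := 2) (N₂ := 1) σ hγ₀g' hframe he1 hu1 heu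
  have hT : (b.val.val : Matrix (Fin 3) (Fin 3) (UnitaryGroup.LocalRing L v)) * (g * P₀).val = (g * P₀).val * D := by
    rw [Units.val_mul, ← Matrix.mul_assoc, ← hgγ, Matrix.mul_assoc, hframe, ← Matrix.mul_assoc]
  have hT' : (b'.val.val : Matrix (Fin 3) (Fin 3) (UnitaryGroup.LocalRing L v)) * (g' * P₀).val = (g' * P₀).val * D := by
    rw [Units.val_mul, ← Matrix.mul_assoc, ← hg'γ, Matrix.mul_assoc, hframe, ← Matrix.mul_assoc]
  have hF : twistGram σ Hv (g * P₀).val = finSum 2 1 G₁ G₂ := by rw [Units.val_mul, twistGram_mul, ← twistGram_def, hGP]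
  have hF' : twistGram σ Hv (g' * P₀).val = finSum 2 1 G'₁ G'₂ := by rw [Units.val_mul, twistGram_mul, ← twistGram_def, hG'P]
  -- hermitian blocks, units, `σ`-invariance (both frames)
  have hHσ : (Hv.map σ)ᵀ = Hv := hH
  have hTf : ((finSum 2 1 G₁ G₂).map σ)ᵀ = finSum 2 1 G₁ G₂ := by rw [← hF]; exact conjTranspose_twistGram σ Hv hσσ hHσ _
  have hTf' : ((finSum 2 1 G'₁ G'₂).map σ)ᵀ = finSum 2 1 G'₁ G'₂ := by rw [← hF']; exact conjTranspose_twistGram σ Hv hσσ hHσ _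
  have hbl : ∀ {A : Matrix (Fin 2) (Fin 2) (UnitaryGroup.LocalRing L v)} {B : Matrix (Fin 1) (Fin 1) (UnitaryGroup.LocalRing L v)},
      ((finSum 2 1 A B).map σ)ᵀ = finSum 2 1 A B → (A.map σ)ᵀ = A ∧ (B.map σ)ᵀ = B := by
    intro A B hAB
    rw [transpose_finSum_map] at hAB
    have h1 := (Matrix.reindex finSumFinEquiv finSumFinEquiv).injective hAB
    rw [Matrix.fromBlocks_inj] at h1
    exact ⟨h1.1, h1.2.2.2⟩
  obtain ⟨hG₁h, hG₂h⟩ := hbl hTf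
  obtain ⟨hG'₁h, hG'₂h⟩ := hbl hTf'
  have hdet : ∀ (Tm : GL (Fin 3) (UnitaryGroup.LocalRing L v)) {A : Matrix (Fin 2) (Fin 2) (UnitaryGroup.LocalRing L v)}
      {B : Matrix (Fin 1) (Fin 1) (UnitaryGroup.LocalRing L v)}, twistGram σ Hv Tm.val = finSum 2 1 A B →
      A.det * B 0 0 = σ Tm.val.det * Hv.det * Tm.val.det := by
    intro Tm A B hAB
    rw [← Matrix.det_fin_one B, ← det_finSum, ← hAB, det_twistGram]
  have hd := hdet (g * P₀) hF
  have hd' := hdet (g' * P₀) hF'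
  have hdg : IsUnit (g * P₀).val.det := Matrix.isUnits_det_units _
  have hdg' : IsUnit (g' * P₀).val.det := Matrix.isUnits_det_units _
  have hTu : IsUnit (G₁.det * G₂ 0 0) := by rw [hd]; exact ((hdg.map σ).mul hHd).mul hdg
  have hTu' : IsUnit (G'₁.det * G'₂ 0 0) := by rw [hd']; exact ((hdg'.map σ).mul hHd).mul hdg'
  have hG₂u : IsUnit (G₂ 0 0) := isUnit_of_mul_isUnit_right hTu
  have hG'₂u : IsUnit (G'₂ 0 0) := isUnit_of_mul_isUnit_right hTu'
  have hG₁d : IsUnit G₁.det := isUnit_of_mul_isUnit_left hTu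
  have hG'₁d : IsUnit G'₁.det := isUnit_of_mul_isUnit_left hTu'
  have hcorner : ∀ {B : Matrix (Fin 1) (Fin 1) (UnitaryGroup.LocalRing L v)}, (B.map σ)ᵀ = B → σ (B 0 0) = B 0 0 := by
    intro B hB
    have hc := congrFun (congrFun hB 0) 0
    rwa [transpose_apply, map_apply] at hc
  have hG₂σ := hcorner hG₂h
  have hG'₂σ := hcorner hG'₂h
  -- the signs: `κ(b′) = −κ(b)`, read on the corners
  have hκ := finKappaAt_eq_neg_of_not_isConj_of_fst_eq_smul_one L v H' a b b' w hw h h' hu hH hHd ha hne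
  have hTd : (b.val.val : Matrix (Fin 3) (Fin 3) (UnitaryGroup.LocalRing L v)) * (g * P₀).val = (g * P₀).val * diagonal ![e, e, u] := by
    rw [← hDdiag]; exact hT
  have hTd' : (b'.val.val : Matrix (Fin 3) (Fin 3) (UnitaryGroup.LocalRing L v)) * (g' * P₀).val = (g' * P₀).val * diagonal ![e, e, u] := by
    rw [← hDdiag]; exact hT'
  have hκb := finKappaAt_eq_ite_twistGram_eigenframe L v H' a b hv h hu hTd hj
  have hκb' := finKappaAt_eq_ite_twistGram_eigenframe L v H' a b' hv h' hu hTd' hj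
  have hjfin : ∀ {A : Matrix (Fin 2) (Fin 2) (UnitaryGroup.LocalRing L v)} {B : Matrix (Fin 1) (Fin 1) (UnitaryGroup.LocalRing L v)},
      finSum 2 1 A B j j = B 0 0 := by
    intro A B
    rw [hjdef, finSum_apply_inr₇]
  rw [hF, hjfin] at hκb
  rw [hF', hjfin] at hκb'
  -- if `G′₁` were isotropic both `−det G₁` and `−det G′₁` would be norms, forcing equal signs
  by_contra hb'
  -- §1 contrapositive at `b`: `G₁` is isotropic
  have hiso : ∃ x : Fin 2 → UnitaryGroup.LocalRing L v, x ≠ 0 ∧ hermForm σ G₁ x x = 0 := by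
    by_contra hno
    simp only [not_exists, not_and] at hno
    exact hb (compactSpace_centralizer_of_frame_of_anisotropic L v H' b w hw heu hT hF (fun x hx => not_ne_iff.1 fun hx0 => hno x hx0 hx) hG₂u)
  have hiso' : ∃ x : Fin 2 → UnitaryGroup.LocalRing L v, x ≠ 0 ∧ hermForm σ G'₁ x x = 0 := by
    by_contra hno
    simp only [not_exists, not_and] at hno
    exact hb' (compactSpace_centralizer_of_frame_of_anisotropic L v H' b' w hw heu hT' hF' (fun x hx => not_ne_iff.1 fun hx0 => hno x hx0 hx)
      hG'₂u)
  have hN : ∀ s : UnitaryGroup.LocalRing L v, σ s * s = 0 → s = 0 := by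
    letI : Field (UnitaryGroup.LocalRing L v) :=
      (Liu2021.LemD1IndexedNonVacuityNonsplitPlace.isField_localRing_of_nonsplit L v (IsCMField.complexConj L) hcδ hδ w hw).toField
    intro s hs
    rcases mul_eq_zero.1 hs with h0 | h0
    · exact (map_eq_zero_iff σ (RingHom.injective _)).1 h0
    · exact h0
  have hh10 : ∀ {A : Matrix (Fin 2) (Fin 2) (UnitaryGroup.LocalRing L v)}, (A.map σ)ᵀ = A → σ (A 0 0) = A 0 0 ∧ A 1 0 = σ (A 0 1) := by
    intro A hA
    exact ⟨by have hc := congrFun (congrFun hA 0) 0; rwa [transpose_apply, map_apply] at hc,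
      by have hc := congrFun (congrFun hA 1) 0; rw [transpose_apply, map_apply] at hc; exact hc.symm⟩
  obtain ⟨x₀, hx₀, hx₀0⟩ := hiso
  obtain ⟨x₁, hx₁, hx₁0⟩ := hiso'
  have hfield : ∀ s : UnitaryGroup.LocalRing L v, s ≠ 0 → IsUnit s := fun s hs =>
    isUnit_localRing_of_ne_zero_of_subsingleton L v hv hs
  obtain ⟨z₀, hz₀⟩ := exists_neg_det_eq_norm_of_hermForm_eq_zero σ hfield hN (hh10 hG₁h).1 (hh10 hG₁h).2 hx₀ hx₀0
  obtain ⟨z₁, hz₁⟩ := exists_neg_det_eq_norm_of_hermForm_eq_zero σ hfield hN (hh10 hG'₁h).1 (hh10 hG'₁h).2 hx₁ hx₁0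
  have hn₀ : IsUnit (σ z₀ * z₀) := by rw [← hz₀]; exact hG₁d.neg
  have hn₁ : IsUnit (σ z₁ * z₁) := by rw [← hz₁]; exact hG'₁d.neg
  have hz₀u : IsUnit z₀ := isUnit_of_mul_isUnit_right hn₀
  have hz₁u : IsUnit z₁ := isUnit_of_mul_isUnit_right hn₁
  -- `N(z₁ d) G′₂ = N(z₀ d′) G₂` (both are `−det H′_v · N(d) N(d′)`), so `G′₂ = N(q) G₂`
  have hrel := norm_frame_rel₇ σ hz₀ hz₁ hd hd'
  obtain ⟨q, hqu, hq⟩ := exists_norm_mul_of_norm_mul_eq₇ σ (hz₁u.mul hdg) (hz₀u.mul hdg') hrel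
  -- index two: the two norm tests agree, so `κ(b′) = κ(b)` — contradiction
  have htests := (exists_norm_mul_iff_norm_tests_iff L v (IsCMField.complexConj L) hcδ hδ w hw hG₂σ hG₂u hG'₂σ hG'₂u
    (map_one σ) isUnit_one).1 ⟨q, hqu, hq⟩
  have hconv : ∀ t : UnitaryGroup.LocalRing L v,
      (∃ z : UnitaryGroup.LocalRing L v, IsUnit z ∧ t = σ z * z * 1) ↔ (∃ z : UnitaryGroup.LocalRing L v, IsUnit z ∧ t = z * σ z) := by
    intro t
    refine exists_congr fun z => ?_
    rw [mul_one, mul_comm (σ z) z]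
  rw [hconv, hconv] at htests
  have hne0 := finKappaAt_ne_zero_of_isUnit L v H' a b h hu
  by_cases hC : ∃ z : UnitaryGroup.LocalRing L v, IsUnit z ∧ G₂ 0 0 = z * σ z
  · rw [if_pos hC] at hκb
    rw [if_pos (htests.2 hC)] at hκb'
    omega
  · rw [if_neg hC] at hκb
    rw [if_neg (fun h1 => hC (htests.1 h1))] at hκb'
    omega

end Dock

end Literature.NumberTheory.Rogawski1990
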